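import Summits.QuantumFields.BalabanUV.Beta.E3LevelOneReflection

/-!
# Transport of a stencil reflection law (with contact) to the `K`-generic chain-rule vertex and its resolvent sandwich — any level

HONEST FRAMING (pub-balaban β cell). Discharging `BetaPertH` makes Balaban's UV stability UNCONDITIONAL — a real
constructive-QFT result; it is NOT the continuum limit and NOT the Clay problem. This module is NOT (D1), NOT `BetaPertH`.
HONEST DEPENDENCY: continuum YM on `T⁴` ⇐ `BetaPertH` ∧ nine spine estimates (0/9 proved); `BetaPertH` ⇐ (D1) ∧ (D4) ∧ CAP+tail.

WHAT IS PROVED ([folklore] kernel algebra; no analytic number is produced). Lineage an3; the LEVEL-GENERIC half of the row owner's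
recursion over the composite stencil ((L3-D), an2 DECISION journal l.7124: `e3OfKAt K S κ′ u′ := −mmRead N (K ∘ vertexOfK K N S κ′ u′ ∘ K)`).
Fix a blocking modulus `N ≥ 1`, an axis `α`, a LOCAL stencil family `S` (`LocStencil S Cs δ`, `δ > 0`) obeying a reflection law WITH
CONTACT family `C`,
                    `S κ (bref α κ u) = reflSign α κ • refK (Φ N α) (S κ u + C κ u)`            (hSr)
and a packed kernel `K` that decays (`TameKernelCalculus.Spr K`) and is reflection-invariant (`refK (Φ N α) K = K`). Then:
* §1 `locStencil_contact_of_law`: the contact family `C` is itself a local stencil family (it IS `ε • refK Φ (S κ (bref u)) − S κ u`;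
  locality is reflection-stable, `E3LevelOneReflection.biLoc_refK_Φ`, and `sref α (bref α κ u)` is within `ℓ¹`-distance `1` of `u`).
* §2 `loc_vertexOfK`: `vertexOfK K N S μ y` is localised for every local family (packaging of `vertexFamily_vertexOfK'`).
* §3 **THE TRANSPORT** `neg_mmRead_sandwich_vertexOfK_bref`:
    `−mmRead N (K ∘ vertexOfK K N S μ (bref α μ y) ∘ K)
        = reflSign α μ • refK (Φ N α) (−mmRead N (K ∘ vertexOfK K N S μ y ∘ K) + −mmRead N (K ∘ vertexOfK K N C μ y ∘ K))`
  — the law of `S` with contact `C` becomes the law of the sandwiched vertex with contact "the sandwiched vertex OF THE CONTACT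
  FAMILY", through the same weights; plus the field–field entries `…_inl_inl` in the spelling of the socket `hE3ff` and the reduction
  `sandwichLaw_ff_iff`: an `hE3ff`-shaped law with a candidate `C′` in the contact slot holds iff
  `(−mmRead N (K ∘ vertexOfK K N C μ y ∘ K))_ff = C′_ff`.
The level-1 instance (`S = S0NAt`, contact family `(cVH/Lc^{d+1}) • conjV bhKAt (diagK ctGen)`) is `E3LevelOneReflection` /
`E3GenericReflection`; this module is what the recursion `j − 1 ↦ j` consumes once the level-`(j−1)` stencil law is known.
It asserts nothing about any particular stencil family or resolvent.
-/

noncomputable section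

open Finset
open scoped BigOperators
open Literature.MathematicalPhysics.QuantumFieldTheory
open Literature.MathematicalPhysics.QuantumFieldTheory.Balaban1983to89
open Literature.MathematicalPhysics.QuantumFieldTheory.Balaban1983to89.Beta
open B12Sec2to5 (l1 l1_nonneg)
open ExpKernelCalculus (MKer comp Decays BiLoc VertexFamily)
open PolarizationSign (reflSign)
open KernelReflection (LegMap refK refK_apply)
open ResolventReflection (sref sref_apply bref bref_bref bref_apply Φ Φ_r_inl Φ_r_inr Φ_s_inl Φ_s_inr reflSign_mul_self)
open OneStepResolventKernel (Fib LocStencil)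
open OneStepKernelFamily (colH vertexOfK vertexFamily_vertexOfK')
open BalabanStepJetsSucc (mmRead)
open KernelWard (biLoc_sub biLoc_recentre)
open StepJetData (biLoc_smul biLoc_weaken)
open Summit.QuantumFields.BalabanUV.Beta.TameKernelCalculus (Spr Loc Tame slice_tame)
open Summit.QuantumFields.BalabanUV.Beta.VertexReflectionContact (vertexOfK_bref_contact summable_colH_mul_of_locStencil
  neg_mmRead_sandwich_bref)
open Summit.QuantumFields.BalabanUV.Beta.E3LevelOneReflection (Φ_r_r abs_Φ_s contact_eq_of_law biLoc_refK_Φ)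

namespace Summit.QuantumFields.BalabanUV.Beta.VertexSandwichTransport

variable {d N : ℕ}

/-- [folklore] A spread kernel decays at a positive rate with a nonnegative constant. -/
theorem decays_of_spr {K : MKer (d + 1) (Fib d)} (hK : Spr K) : ∃ δ C : ℝ, 0 < δ ∧ 0 ≤ C ∧ Decays K C δ := by
  obtain ⟨C, δ, hδ, h⟩ := hK
  have h0 := h 0 0 (Sum.inl 0) (Sum.inl 0)
  have h1 : 0 ≤ C * Real.exp (-δ * l1 ((0 : Fin (d + 1) → ℤ) - 0)) := (abs_nonneg _).trans h0
  exact ⟨δ, C, hδ, nonneg_of_mul_nonneg_left h1 (Real.exp_pos _), h⟩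

/-! ## §1 The contact family of a stencil law is a local stencil family -/

/-- [folklore] `sref α (bref α κ u)` is within `ℓ¹`-distance one of `u` (it is `u + [κ = α]·e_α`). -/
theorem l1_sref_bref_sub_le (α κ : Fin (d + 1)) (u : Fin (d + 1) → ℤ) : l1 (sref α (bref α κ u) - u) ≤ 1 := by
  classical
  have key : ∀ i, |(((sref α (bref α κ u) - u) i : ℤ) : ℝ)| ≤ if i = α then 1 else 0 := by
    intro i
    simp only [Pi.sub_apply, sref_apply, bref_apply]
    by_cases hi : i = α
    · simp only [hi, if_true]
      by_cases hκ : κ = α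
      · simp only [hκ, if_true]; push_cast; rw [abs_le]; constructor <;> linarith
      · simp only [hκ, if_false]; push_cast; rw [abs_le]; constructor <;> linarith
    · simp [hi]
  calc l1 (sref α (bref α κ u) - u) = ∑ i, |(((sref α (bref α κ u) - u) i : ℤ) : ℝ)| := rfl
    _ ≤ ∑ i, (if i = α then (1 : ℝ) else 0) := Finset.sum_le_sum fun i _ => key i
    _ = 1 := by rw [Finset.sum_ite_eq' Finset.univ α]; simp

/-- [folklore] **THE CONTACT FAMILY OF A REFLECTION LAW IS A LOCAL STENCIL FAMILY**: if `S` is local and obeys (hSr), then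
`C κ u = reflSign α κ • refK (Φ N α) (S κ (bref α κ u)) − S κ u` is local at the same rate. -/
theorem locStencil_contact_of_law [NeZero N] {S C : Fin (d + 1) → (Fin (d + 1) → ℤ) → MKer (d + 1) (Fib d)} {Cs δ : ℝ}
    (hS : LocStencil S Cs δ) (hδ : 0 ≤ δ) {α : Fin (d + 1)}
    (hSr : ∀ κ u, S κ (bref α κ u) = reflSign α κ • refK (Φ (d := d) N α) (S κ u + C κ u)) :
    LocStencil C (|Cs| * Real.exp (δ * (4 * N)) * Real.exp (δ * 2) + Cs) δ := by
  have hN : 1 ≤ N := Nat.one_le_iff_ne_zero.2 (NeZero.ne N)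
  intro κ u
  rw [contact_eq_of_law (hSr κ u)]
  -- the reflected stencil, bi-localised at `sref α (bref α κ u)`, recentred at `u`
  have h1 : BiLoc (refK (Φ (d := d) N α) (S κ (bref α κ u))) (sref α (bref α κ u)) (sref α (bref α κ u))
      (|Cs| * Real.exp (δ * (4 * N))) δ := biLoc_refK_Φ hN (hS κ (bref α κ u)) hδ α
  have h2 := biLoc_recentre h1 hδ u u
  have hl := l1_sref_bref_sub_le (d := d) α κ u
  have h3 : BiLoc (refK (Φ (d := d) N α) (S κ (bref α κ u))) u u (|Cs| * Real.exp (δ * (4 * N)) * Real.exp (δ * 2)) δ := by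
    refine biLoc_weaken h2 ?_ le_rfl
    refine mul_le_mul_of_nonneg_left (Real.exp_le_exp.mpr ?_) (by positivity)
    nlinarith [l1_nonneg (sref α (bref α κ u) - u)]
  have h4 := biLoc_smul h3 (reflSign α κ)
  have hε : |reflSign α κ| = 1 := by
    rcases mul_self_eq_one_iff.mp (reflSign_mul_self α κ) with h | h <;> simp [h]
  rw [hε, one_mul] at h4
  exact biLoc_sub h4 (hS κ u)

/-! ## §2 The `K`-generic vertex of a local family is localised -/

/-- [folklore] `vertexOfK K N S μ y` is localised for a spread `K` and a local family `S`. -/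
theorem loc_vertexOfK {K : MKer (d + 1) (Fib d)} (hKs : Spr K) {S : Fin (d + 1) → (Fin (d + 1) → ℤ) → MKer (d + 1) (Fib d)}
    {Cs δ : ℝ} (hS : LocStencil S Cs δ) (hδ : 0 < δ) (μ : Fin (d + 1)) (y : Fin (d + 1) → ℤ) :
    Loc (vertexOfK K N S μ y) := by
  obtain ⟨Cv, δv, hδv, hV⟩ := vertexFamily_vertexOfK' (N := N) (decays_of_spr hKs) hS hδ
  exact ⟨_, _, Cv, δv, hδv, hV μ y⟩

/-! ## §3 The transport -/

/-- [folklore] **TRANSPORT OF A STENCIL LAW WITH CONTACT TO THE SANDWICHED `K`-GENERIC VERTEX** (any level `N ≥ 1`):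
`−mmRead N (K ∘ vertexOfK K N S μ (bref α μ y) ∘ K) = ε • refK (Φ N α) (−mmRead N (K ∘ vertexOfK K N S μ y ∘ K) +
−mmRead N (K ∘ vertexOfK K N C μ y ∘ K))`. -/
theorem neg_mmRead_sandwich_vertexOfK_bref [NeZero N] {S C : Fin (d + 1) → (Fin (d + 1) → ℤ) → MKer (d + 1) (Fib d)}
    {Cs δ : ℝ} (hS : LocStencil S Cs δ) (hδ : 0 < δ) {α : Fin (d + 1)}
    (hSr : ∀ κ u, S κ (bref α κ u) = reflSign α κ • refK (Φ (d := d) N α) (S κ u + C κ u))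
    {K : MKer (d + 1) (Fib d)} (hKs : Spr K) (hKr : refK (Φ (d := d) N α) K = K) (μ : Fin (d + 1)) (y : Fin (d + 1) → ℤ) :
    -mmRead N (comp (comp K (vertexOfK K N S μ (bref α μ y))) K) =
      reflSign α μ • refK (Φ (d := d) N α)
        (-mmRead N (comp (comp K (vertexOfK K N S μ y)) K) + -mmRead N (comp (comp K (vertexOfK K N C μ y)) K)) := by
  have hKd := decays_of_spr hKs
  have hCl := locStencil_contact_of_law hS hδ.le hSr
  have hKt : Tame K := hKs.tame
  have hVl : ∀ y', Loc (vertexOfK K N S μ y') := fun y' => loc_vertexOfK hKs hS hδ μ y'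
  have hWl : Loc (vertexOfK K N C μ y) := loc_vertexOfK hKs hCl hδ μ y
  have hV := vertexOfK_bref_contact hKr hSr
    (fun μ y κ' x z a b => summable_colH_mul_of_locStencil hKd hS hδ μ y κ' x z a b)
    (fun μ y κ' x z a b => summable_colH_mul_of_locStencil hKd hCl hδ μ y κ' x z a b) μ y
  exact neg_mmRead_sandwich_bref (M := N) (N' := N) (V := vertexOfK K N S) (W := vertexOfK K N C) hKr hV
    (fun x z a f b => slice_tame hKt (hVl y).tame x z a f b) (fun x z a f b => slice_tame hKt hWl.tame x z a f b)
    (fun x z a f b => slice_tame (hKs.comp_loc (hVl y)).tame hKt x z a f b)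
    (fun x z a f b => slice_tame (hKs.comp_loc hWl).tame hKt x z a f b)

/-- [folklore] **THE TRANSPORTED LAW ON FIELD–FIELD ENTRIES, in the spelling of the socket `hE3ff`.** -/
theorem neg_mmRead_sandwich_vertexOfK_bref_inl_inl [NeZero N] {S C : Fin (d + 1) → (Fin (d + 1) → ℤ) → MKer (d + 1) (Fib d)}
    {Cs δ : ℝ} (hS : LocStencil S Cs δ) (hδ : 0 < δ) {α : Fin (d + 1)}
    (hSr : ∀ κ u, S κ (bref α κ u) = reflSign α κ • refK (Φ (d := d) N α) (S κ u + C κ u))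
    {K : MKer (d + 1) (Fib d)} (hKs : Spr K) (hKr : refK (Φ (d := d) N α) K = K) (μ : Fin (d + 1))
    (y x z : Fin (d + 1) → ℤ) (a b : Fin (d + 1)) :
    (-mmRead N (comp (comp K (vertexOfK K N S μ (bref α μ y))) K)) x z (Sum.inl a) (Sum.inl b) =
      reflSign α μ * ((Φ (d := d) N α).s (Sum.inl a) * (Φ (d := d) N α).s (Sum.inl b) *
        ((-mmRead N (comp (comp K (vertexOfK K N S μ y)) K))
            ((Φ (d := d) N α).r (Sum.inl a) x) ((Φ (d := d) N α).r (Sum.inl b) z) (Sum.inl a) (Sum.inl b) +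
          (-mmRead N (comp (comp K (vertexOfK K N C μ y)) K))
            ((Φ (d := d) N α).r (Sum.inl a) x) ((Φ (d := d) N α).r (Sum.inl b) z) (Sum.inl a) (Sum.inl b))) := by
  rw [neg_mmRead_sandwich_vertexOfK_bref hS hδ hSr hKs hKr μ y]
  simp only [Pi.smul_apply, smul_eq_mul, refK_apply, Pi.add_apply]

/-- [folklore] **THE TRANSPORTED SOCKET IS A CONTACT EVALUATION**: for any candidate `C′`, the `hE3ff`-shaped law with `C′` in the
contact slot holds at `(α, μ, y)` on all field–field entries iff `−mmRead N (K ∘ vertexOfK K N C μ y ∘ K)` and `C′` have the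
same field–field block. -/
theorem sandwichLaw_ff_iff [NeZero N] {S C : Fin (d + 1) → (Fin (d + 1) → ℤ) → MKer (d + 1) (Fib d)}
    {Cs δ : ℝ} (hS : LocStencil S Cs δ) (hδ : 0 < δ) {α : Fin (d + 1)}
    (hSr : ∀ κ u, S κ (bref α κ u) = reflSign α κ • refK (Φ (d := d) N α) (S κ u + C κ u))
    {K : MKer (d + 1) (Fib d)} (hKs : Spr K) (hKr : refK (Φ (d := d) N α) K = K) (μ : Fin (d + 1))
    (y : Fin (d + 1) → ℤ) (C' : MKer (d + 1) (Fib d)) :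
    (∀ (x z : Fin (d + 1) → ℤ) (a b : Fin (d + 1)),
      (-mmRead N (comp (comp K (vertexOfK K N S μ (bref α μ y))) K)) x z (Sum.inl a) (Sum.inl b) =
        reflSign α μ * ((Φ (d := d) N α).s (Sum.inl a) * (Φ (d := d) N α).s (Sum.inl b) *
          ((-mmRead N (comp (comp K (vertexOfK K N S μ y)) K))
              ((Φ (d := d) N α).r (Sum.inl a) x) ((Φ (d := d) N α).r (Sum.inl b) z) (Sum.inl a) (Sum.inl b) +
            C' ((Φ (d := d) N α).r (Sum.inl a) x) ((Φ (d := d) N α).r (Sum.inl b) z) (Sum.inl a) (Sum.inl b)))) ↔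
    (∀ (x z : Fin (d + 1) → ℤ) (a b : Fin (d + 1)),
      (-mmRead N (comp (comp K (vertexOfK K N C μ y)) K)) x z (Sum.inl a) (Sum.inl b) = C' x z (Sum.inl a) (Sum.inl b)) := by
  have hε : reflSign α μ ≠ 0 := fun h => by simpa [h] using reflSign_mul_self α μ
  have hs : ∀ c : Fib d, (Φ (d := d) N α).s c ≠ 0 := fun c h => by simpa [h] using (Φ (d := d) N α).s_mul_s c
  constructor
  · intro h x z a b
    have h1 := h ((Φ (d := d) N α).r (Sum.inl a) x) ((Φ (d := d) N α).r (Sum.inl b) z) a b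
    rw [neg_mmRead_sandwich_vertexOfK_bref_inl_inl hS hδ hSr hKs hKr, Φ_r_r, Φ_r_r] at h1
    have h2 := mul_left_cancel₀ hε h1
    have h3 := mul_left_cancel₀ (mul_ne_zero (hs _) (hs _)) h2
    exact add_left_cancel h3
  · intro h x z a b
    rw [neg_mmRead_sandwich_vertexOfK_bref_inl_inl hS hδ hSr hKs hKr, h]

end Summit.QuantumFields.BalabanUV.Beta.VertexSandwichTransport

end
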